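import Summits.NavierStokesRegularity.NavierStokesRegularity.Theorems.SoloRefuteZajaczkowski2023
import HarnessLib

/-!
# C179 `Zajaczkowski2023` — records companion of #162: Lemma 3.3's axis hypothesis is LOAD-BEARING

Row #162 (D-0090 map) letters C179 (arXiv:2304.00856v1) at `Literature.Claims.NS.Zajaczkowski2023.Step3_PlanItem3`
(plan item 3 p.6 l.40–43; `…Zajaczkowski2023Columnar.not_Step3_PlanItem3`) with the Edison clause: Lemma 3.3 AS
PRINTED, WITH its hypothesis «Let ψ₁ be such weak solution to problem (3.1) that it vanishes on the axis of
symmetry» (p.17 l.26–27), is TRUE-type (`Step_L33`) and gives only `ClaimedTheoremAxis` (Remark 3.4 p.18 l.53–55).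
This file certifies that the hypothesis cannot be dropped from Lemma 3.3 itself: the weighted estimate (3.25)
p.17 l.28–57 `∫_Ω ψ²_{1,zz}/r² + ψ²_{1,zrr} + ψ²_{1,zr}/r² + ψ²_{1,z}/r⁴ ≤ c‖ω_{1,z}‖²_{L₂(Ω)}` (`Ineq325`) FAILS on
the print's own solution class of (3.1), for every constant `c`. WITNESS (R = a = 1; W4 family, first
`x₂`-dependent member), `ρ = x₀² + x₁² = r²`: `ψ₁ = (1 − ρ) cos(π x₂)`, `ω₁ = (8 + π²(1 − ρ)) cos(π x₂)` — `C^∞`,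
axisymmetric, `2`-periodic, `ψ₁|_{r=1} = 0`, `Δψ₁ = −(4 + π²(1 − ρ)) cos(π x₂)`, `ψ_{1,r} = −2r cos(π x₂)`, hence
`−Δψ₁ − (2/r)ψ_{1,r} = ω₁` off the axis (`SolvesStream 1 1 ψ₁ ω₁`); but `ψ_{1,z} = −π(1 − ρ) sin(π x₂) ≠ 0` on the
axis, and the balls `B_δ = B((3δ,0,½), δ)`, `0 < δ ≤ 1/8`, lie in `Ω` with `ψ²_{1,z} ≥ 1` and `r⁴ < 289δ⁴` there, so
`∫_Ω ψ²_{1,z} r⁻⁴ ≥ |B₁|/(289 δ)` for every `δ` (`Measure.addHaar_ball_of_pos`, no Fubini): the left side is `⊤`,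
while the right side is `≤ c · 9216 · |B(0,2)| < ⊤`.
Main results (namespace `…Theorems.Zajaczkowski2023AxisWeight`, new): `psiZ`, `omZ`, `solvesStream_psiZ`,
`dZ_psiZ`, `dZ_psiZ_axisPt`, `lintegral_lhs325_eq_top`, `rhs325_lt_top`, `not_ineq325_psiZ`,
`step_L33_false_without_axis : ¬ (∀ R a > 0, ∃ c > 0, ∀ ψ₁ ω₁, SolvesStream R a ψ₁ ω₁ → Ineq325 R a c ψ₁ ω₁)`
(= `Step_L33` with its axis hypothesis deleted). Nothing keyed to #162 moves; this is negative knowledge about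
the METHOD: an a-priori chain through (3.25) for the whole class (1.6) must first change the `r⁻⁴` axis weight.
WHAT THIS IS NOT: not a claim about NS regularity or blow-up; not a claim about any author beyond the typed
locator [cite: Zajaczkowski2023, Lemma 3.3 (3.25) p.17 l.26–57; Remark 3.4 p.18 l.53–55; plan item 3 p.6 l.40–43].
-/

noncomputable section

set_option linter.dupNamespace false

open Set Function WithLp MeasureTheory Metric
open scoped ContDiff Laplacian InnerProductSpace RealInnerProductSpace ENNReal

namespace Summit.NavierStokesRegularity.NavierStokesRegularity.Theorems.Zajaczkowski2023AxisWeight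

open Summit.NavierStokesRegularity.NavierStokesRegularity.Theorems.RotatingEulerWindowProfileLinearRung (hasFDerivAt_coord)
open Summit.NavierStokesRegularity.NavierStokesRegularity.Theorems.Zajaczkowski2023Columnar
  (rho hasFDerivAt_rho contDiff_rho contDiff_coord rho_eq_cylRadius_sq rho_add_axial)
open Literature.Analysis.FluidPDE Literature.Claims.NS.Zajaczkowski2023
open scoped Real

/-! ## The witness `ψ₁ = (1 − ρ) cos(π x₂)`, `ω₁ = (8 + π²(1 − ρ)) cos(π x₂)` -/

/-- `G = 1 − ρ = 1 − r²`. [folklore] -/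
def gW (y : E3) : ℝ := 1 - rho y

/-- `H = cos(π x₂)`. [folklore] -/
def hW (y : E3) : ℝ := Real.cos (π * y 2)

/-- `S = −π sin(π x₂) = H'`. [folklore] -/
def sZ (y : E3) : ℝ := -(π * Real.sin (π * y 2))

/-- The witness stream variable `ψ₁ = (1 − r²) cos(π x₂)`. [cite: Zajaczkowski2023, (3.1) p.11 l.97–104] -/
def psiZ (y : E3) : ℝ := gW y * hW y

/-- The witness datum `ω₁ = (8 + π²(1 − r²)) cos(π x₂)`. [cite: Zajaczkowski2023, (3.1) p.11 l.97–104] -/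
def omZ (y : E3) : ℝ := (8 + π ^ 2 * gW y) * hW y

/-- Coordinate projections `dx₀, dx₁, dx₂`. [folklore] -/
abbrev P0 : E3 →L[ℝ] ℝ := EuclideanSpace.proj (0 : Fin 3)
/-- `dx₁`. [folklore] -/
abbrev P1 : E3 →L[ℝ] ℝ := EuclideanSpace.proj (1 : Fin 3)
/-- `dx₂`. [folklore] -/
abbrev P2 : E3 →L[ℝ] ℝ := EuclideanSpace.proj (2 : Fin 3)

/-- `DG(x) = −2x₀ dx₀ − 2x₁ dx₁`. [folklore] -/
theorem hasFDerivAt_gW (x : E3) : HasFDerivAt gW (-((2 * x 0) • P0 + (2 * x 1) • P1)) x :=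
  (hasFDerivAt_rho x).const_sub 1

/-- `DH(x) = S(x) dx₂`. [folklore] -/
theorem hasFDerivAt_hW (x : E3) : HasFDerivAt hW (sZ x • P2) x := by
  have h : HasFDerivAt (fun y : E3 => Real.cos (π * y 2)) _ x := ((hasFDerivAt_coord 2 x).const_mul π).cos
  refine h.congr_fderiv ?_; ext w; simp [sZ]; ring

/-- `DS(x) = −π² H(x) dx₂`. [folklore] -/
theorem hasFDerivAt_sZ (x : E3) : HasFDerivAt sZ ((-(π ^ 2 * hW x)) • P2) x := by
  have h : HasFDerivAt (fun y : E3 => -(π * Real.sin (π * y 2))) _ x :=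
    (((hasFDerivAt_coord 2 x).const_mul π).sin.const_mul π).neg
  refine h.congr_fderiv ?_; ext w; simp [hW]; ring

/-- `G`, `H`, `S` are smooth. [folklore] -/
theorem contDiff_gW {n : WithTop ℕ∞} : ContDiff ℝ n gW := contDiff_const.sub contDiff_rho

/-- `H` is smooth. [folklore] -/
theorem contDiff_hW {n : WithTop ℕ∞} : ContDiff ℝ n hW :=
  Real.contDiff_cos.comp (contDiff_const.mul (contDiff_coord 2))

/-- `S` is smooth. [folklore] -/
theorem contDiff_sZ {n : WithTop ℕ∞} : ContDiff ℝ n sZ :=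
  (contDiff_const.mul (Real.contDiff_sin.comp (contDiff_const.mul (contDiff_coord 2)))).neg

/-- `ψ₁` is smooth. [folklore] -/
theorem contDiff_psiZ {n : WithTop ℕ∞} : ContDiff ℝ n psiZ := contDiff_gW.mul contDiff_hW

/-- `ω₁` is smooth. [folklore] -/
theorem contDiff_omZ {n : WithTop ℕ∞} : ContDiff ℝ n omZ :=
  (contDiff_const.add (contDiff_const.mul contDiff_gW)).mul contDiff_hW

/-- `Dψ₁(x) w = −2(x₀w₀ + x₁w₁) H(x) + G(x) S(x) w₂`. [folklore] -/
theorem fderiv_psiZ_apply (x w : E3) :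
    fderiv ℝ psiZ x w = -(2 * x 0 * w 0 + 2 * x 1 * w 1) * hW x + gW x * sZ x * w 2 := by
  have h : HasFDerivAt (fun y : E3 => gW y * hW y) _ x := (hasFDerivAt_gW x).mul (hasFDerivAt_hW x)
  rw [show psiZ = fun y => gW y * hW y from rfl, h.fderiv]; simp; ring

/-- `Dω₁(x) w = −2π²(x₀w₀ + x₁w₁) H(x) + (8 + π² G(x)) S(x) w₂`. [folklore] -/
theorem fderiv_omZ_apply (x w : E3) :
    fderiv ℝ omZ x w = -(π ^ 2 * (2 * x 0 * w 0 + 2 * x 1 * w 1)) * hW x + (8 + π ^ 2 * gW x) * sZ x * w 2 := by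
  have h : HasFDerivAt (fun y : E3 => (8 + π ^ 2 * gW y) * hW y) _ x :=
    (((hasFDerivAt_gW x).const_mul (π ^ 2)).const_add 8).mul (hasFDerivAt_hW x)
  rw [show omZ = fun y => (8 + π ^ 2 * gW y) * hW y from rfl, h.fderiv]; simp; ring

/-- Pure second partials `∂₀∂₀ψ₁ = ∂₁∂₁ψ₁ = −2H`. [folklore] -/
theorem fderiv_d01_psiZ (j : Fin 3) (hj : j = 0 ∨ j = 1) (x : E3) :
    fderiv ℝ (fun y : E3 => -(2 * y j) * hW y) x (EuclideanSpace.single j (1 : ℝ)) = -2 * hW x := by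
  have h : HasFDerivAt (fun y : E3 => -(2 * y j) * hW y) _ x :=
    ((hasFDerivAt_coord j x).const_mul 2).neg.mul (hasFDerivAt_hW x)
  rw [h.fderiv]; rcases hj with rfl | rfl <;> simp [sZ] <;> ring

/-- Pure second partial `∂₂∂₂ψ₁ = −π² G H`. [folklore] -/
theorem fderiv_d2_psiZ (x : E3) :
    fderiv ℝ (fun y : E3 => gW y * sZ y) x (EuclideanSpace.single 2 (1 : ℝ)) = -(π ^ 2 * gW x * hW x) := by
  have h : HasFDerivAt (fun y : E3 => gW y * sZ y) _ x := (hasFDerivAt_gW x).mul (hasFDerivAt_sZ x)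
  rw [h.fderiv]; simp; ring

/-- **`Δψ₁ = −(4 + π² G) H`.** [folklore] -/
theorem laplacian_psiZ (x : E3) : (Δ psiZ) x = -((4 + π ^ 2 * gW x) * hW x) := by
  rw [laplacian_eq_sum_fderiv_fderiv (EuclideanSpace.basisFun (Fin 3) ℝ) (contDiff_psiZ (n := 2)) x,
    Fin.sum_univ_three]
  have e0 : (fun y => fderiv ℝ psiZ y ((EuclideanSpace.basisFun (Fin 3) ℝ) 0)) = fun y => -(2 * y 0) * hW y := by
    funext y; rw [fderiv_psiZ_apply]; simp
  have e1 : (fun y => fderiv ℝ psiZ y ((EuclideanSpace.basisFun (Fin 3) ℝ) 1)) = fun y => -(2 * y 1) * hW y := by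
    funext y; rw [fderiv_psiZ_apply]; simp
  have e2 : (fun y => fderiv ℝ psiZ y ((EuclideanSpace.basisFun (Fin 3) ℝ) 2)) = fun y => gW y * sZ y := by
    funext y; rw [fderiv_psiZ_apply]; simp
  rw [e0, e1, e2]; simp only [EuclideanSpace.basisFun_apply]
  rw [fderiv_d01_psiZ 0 (Or.inl rfl) x, fderiv_d01_psiZ 1 (Or.inr rfl) x, fderiv_d2_psiZ x]; ring

/-- **`ψ_{1,r} = −2r H`** off the axis. [folklore] -/
theorem dR_psiZ {x : E3} (hx : cylRadius x ≠ 0) : dR psiZ x = -(2 * cylRadius x) * hW x := by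
  unfold dR; rw [fderiv_psiZ_apply]
  have hr2 : cylRadius x ^ 2 = x 0 ^ 2 + x 1 ^ 2 := cylRadius_sq x
  have e0 : eR x 0 = (cylRadius x)⁻¹ * x 0 := by simp [eR]
  have e1 : eR x 1 = (cylRadius x)⁻¹ * x 1 := by simp [eR]
  have e2 : eR x 2 = 0 := by simp [eR]
  rw [e0, e1, e2]
  calc -(2 * x 0 * ((cylRadius x)⁻¹ * x 0) + 2 * x 1 * ((cylRadius x)⁻¹ * x 1)) * hW x + gW x * sZ x * 0
        = -(2 * (cylRadius x)⁻¹ * (x 0 ^ 2 + x 1 ^ 2)) * hW x := by ring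
    _ = -(2 * ((cylRadius x)⁻¹ * cylRadius x) * cylRadius x) * hW x := by rw [← hr2]; ring
    _ = -(2 * cylRadius x) * hW x := by rw [inv_mul_cancel₀ hx]; ring

/-- **`ψ_{1,z} = G S = −π(1 − r²) sin(π x₂)`.** [folklore] -/
theorem dZ_psiZ (x : E3) : dZ psiZ x = gW x * sZ x := by
  unfold dZ; rw [fderiv_psiZ_apply]; simp [eZ]

/-- **`ω_{1,z} = (8 + π² G) S`.** [folklore] -/
theorem dZ_omZ (x : E3) : dZ omZ x = (8 + π ^ 2 * gW x) * sZ x := by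
  unfold dZ; rw [fderiv_omZ_apply]; simp [eZ]

/-- **The witness solves (3.1) off the axis: `−Δψ₁ − (2/r)ψ_{1,r} = ω₁`.** [cite: Zajaczkowski2023, (3.1) p.11 l.97–104] -/
theorem omega1Of_psiZ {x : E3} (hx : cylRadius x ≠ 0) : omega1Of psiZ x = omZ x := by
  unfold omega1Of; rw [laplacian_psiZ, dR_psiZ hx]; unfold omZ; field_simp; ring

/-- `G` is axisymmetric. [folklore] -/
theorem gW_rotZ (θ : ℝ) (x : E3) : gW (rotZ θ x) = gW x := by
  unfold gW; rw [rho_eq_cylRadius_sq, rho_eq_cylRadius_sq, cylRadius_rotZ]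

/-- `H` is axisymmetric. [folklore] -/
theorem hW_rotZ (θ : ℝ) (x : E3) : hW (rotZ θ x) = hW x := by
  unfold hW; rw [rotZ_apply_two]

/-- `ψ₁` is axisymmetric. [folklore] -/
theorem isAxisymmetricScalar_psiZ : IsAxisymmetricScalar psiZ := by
  intro θ x; unfold psiZ; rw [gW_rotZ, hW_rotZ]

/-- `ω₁` is axisymmetric. [folklore] -/
theorem isAxisymmetricScalar_omZ : IsAxisymmetricScalar omZ := by
  intro θ x; unfold omZ; rw [gW_rotZ, hW_rotZ]

/-- `H` is `2`-periodic in `x₂`. [folklore] -/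
theorem hW_add_axial (x : E3) : hW (x + (2 * 1 : ℝ) • EuclideanSpace.single (2 : Fin 3) (1 : ℝ)) = hW x := by
  unfold hW
  have e : (x + (2 * 1 : ℝ) • EuclideanSpace.single (2 : Fin 3) (1 : ℝ)) 2 = x 2 + 2 := by simp
  rw [e, show π * (x 2 + 2) = π * x 2 + 2 * π by ring, Real.cos_add_two_pi]

/-- `G` does not see `x₂`. [folklore] -/
theorem gW_add_axial (x : E3) : gW (x + (2 * 1 : ℝ) • EuclideanSpace.single (2 : Fin 3) (1 : ℝ)) = gW x := by
  unfold gW; rw [rho_add_axial]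

/-- `ψ₁` is `2`-periodic in `x₂`. [folklore] -/
theorem isAxiallyPeriodic_psiZ : IsAxiallyPeriodic (2 * 1) psiZ := by
  intro x; unfold psiZ; rw [gW_add_axial, hW_add_axial]

/-- `ω₁` is `2`-periodic in `x₂`. [folklore] -/
theorem isAxiallyPeriodic_omZ : IsAxiallyPeriodic (2 * 1) omZ := by
  intro x; unfold omZ; rw [gW_add_axial, hW_add_axial]

/-- `ψ₁ = 0` on the wall `{r = 1}`. [folklore] -/
theorem psiZ_wall {x : E3} (hx : cylRadius x = 1) : psiZ x = 0 := by
  have h : gW x = 0 := by unfold gW; rw [rho_eq_cylRadius_sq, hx]; norm_num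
  unfold psiZ; rw [h, zero_mul]

/-- **`SolvesStream 1 1 ψ₁ ω₁`**: an admissible (smooth, axisymmetric, `2`-periodic, `ψ₁|_{r=1} = 0`) solution
of (3.1) in the unit cylinder whose `ψ_{1,z}` does not vanish on the axis. [cite: Zajaczkowski2023, (3.1) p.11 l.97–104; Lemma 2.5 p.10 l.43–47] -/
theorem solvesStream_psiZ : SolvesStream 1 1 psiZ omZ :=
  ⟨contDiff_psiZ, contDiff_omZ, isAxisymmetricScalar_psiZ, isAxisymmetricScalar_omZ,
    isAxiallyPeriodic_psiZ, isAxiallyPeriodic_omZ, fun _ hx => psiZ_wall hx, fun _ _ hx => omega1Of_psiZ hx⟩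

/-- On the axis `ψ_{1,z} = −π sin(π z)`: the witness violates exactly the consequence `ψ_{1,z}|_{r=0} = 0` of
Lemma 3.3's hypothesis. [cite: Zajaczkowski2023, Lemma 3.3 p.17 l.26–27; Remark 3.4 p.18 l.53–55] -/
theorem dZ_psiZ_axisPt (z : ℝ) : dZ psiZ (axisPt z) = -(π * Real.sin (π * z)) := by
  rw [dZ_psiZ]; unfold gW sZ rho axisPt pt; simp

/-! ## The axis weight `r⁻⁴` of (3.25) against `ψ²_{1,z}`: the left side of (3.25) is `⊤` -/

/-- Centre `(3δ, 0, ½)` of the test ball `B_δ = B((3δ,0,½), δ)`. [folklore] -/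
def ctr (δ : ℝ) : E3 := pt (3 * δ) (1 / 2)

/-- Coordinates on the test ball: `|y₀ − 3δ|, |y₁|, |y₂ − ½| < δ`. [folklore] -/
theorem coord_bounds {δ : ℝ} {y : E3} (hy : y ∈ ball (ctr δ) δ) :
    |y 0 - 3 * δ| < δ ∧ |y 1| < δ ∧ |y 2 - 1 / 2| < δ := by
  rw [mem_ball_iff_norm] at hy
  have e0 : (y - ctr δ) 0 = y 0 - 3 * δ := by simp [ctr, pt]
  have e1 : (y - ctr δ) 1 = y 1 := by simp [ctr, pt]
  have e2 : (y - ctr δ) 2 = y 2 - 1 / 2 := by simp [ctr, pt]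
  have h0 := PiLp.norm_apply_le (y - ctr δ) 0; have h1 := PiLp.norm_apply_le (y - ctr δ) 1
  have h2 := PiLp.norm_apply_le (y - ctr δ) 2
  rw [Real.norm_eq_abs] at h0 h1 h2; rw [e0] at h0; rw [e1] at h1; rw [e2] at h2
  exact ⟨lt_of_le_of_lt h0 hy, lt_of_le_of_lt h1 hy, lt_of_le_of_lt h2 hy⟩

/-- On the test ball: `4δ² < r² < 17δ²`. [folklore] -/
theorem rho_bounds {δ : ℝ} (hδ : 0 < δ) {y : E3} (hy : y ∈ ball (ctr δ) δ) :
    4 * δ ^ 2 < rho y ∧ rho y < 17 * δ ^ 2 := by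
  obtain ⟨h0, h1, -⟩ := coord_bounds hy
  rw [abs_lt] at h0 h1; unfold rho; constructor <;> nlinarith

/-- The test ball lies in the cell `Ω = {r < 1, |x₂| < 1}` when `δ ≤ 1/8`. [folklore] -/
theorem ball_subset_cell {δ : ℝ} (hδ : 0 < δ) (hδ' : δ ≤ 1 / 8) : ball (ctr δ) δ ⊆ cell 1 1 := by
  intro y hy
  obtain ⟨-, -, h2⟩ := coord_bounds hy
  obtain ⟨-, hρ⟩ := rho_bounds hδ hy
  rw [abs_lt] at h2
  refine ⟨?_, show -1 < y 2 by linarith, show y 2 < 1 by linarith⟩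
  have hr0 := cylRadius_nonneg y
  have hr2 : cylRadius y ^ 2 < 1 := by rw [← rho_eq_cylRadius_sq]; nlinarith
  nlinarith

/-- On the test ball `ψ²_{1,z} ≥ 1` (`π(1 − r²) sin(π x₂) ≥ 3 · (47/64) · (7/8) > 1`). [folklore] -/
theorem one_le_dZ_psiZ_sq {δ : ℝ} (hδ : 0 < δ) (hδ' : δ ≤ 1 / 8) {y : E3} (hy : y ∈ ball (ctr δ) δ) :
    1 ≤ dZ psiZ y ^ 2 := by
  obtain ⟨-, -, h2⟩ := coord_bounds hy
  obtain ⟨-, hρ⟩ := rho_bounds hδ hy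
  have hG : 47 / 64 ≤ gW y := by unfold gW; nlinarith
  -- `sin(π y₂) = cos(π(y₂ − ½)) ≥ 1 − (π(y₂ − ½))²/2 ≥ 7/8`
  have ht : |π * y 2 - π / 2| ≤ 1 / 2 := by
    rw [show π * y 2 - π / 2 = π * (y 2 - 1 / 2) by ring, abs_mul, abs_of_pos Real.pi_pos]
    calc π * |y 2 - 1 / 2| ≤ 4 * (1 / 8) := by gcongr; exacts [Real.pi_le_four, h2.le.trans hδ']
      _ = 1 / 2 := by norm_num
  have hsin : 7 / 8 ≤ Real.sin (π * y 2) := by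
    rw [← Real.cos_sub_pi_div_two]
    have hc := Real.one_sub_sq_div_two_le_cos (x := π * y 2 - π / 2)
    have hsq : (π * y 2 - π / 2) ^ 2 ≤ (1 / 2) ^ 2 := by rw [← sq_abs]; gcongr
    linarith
  have hprod : 1 ≤ π * gW y * Real.sin (π * y 2) := by
    nlinarith [mul_le_mul hG hsin (by norm_num) (by linarith), Real.pi_gt_three]
  rw [dZ_psiZ]; unfold sZ; nlinarith

/-- On the test ball the fourth term of (3.25)'s left side dominates `1/(289 δ⁴)`. [folklore] -/
theorem weight_lower_bound {δ : ℝ} (hδ : 0 < δ) (hδ' : δ ≤ 1 / 8) {y : E3} (hy : y ∈ ball (ctr δ) δ) :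
    ENNReal.ofReal (1 / (289 * δ ^ 4)) ≤ ENNReal.ofReal (dZ psiZ y ^ 2 / cylRadius y ^ 4) := by
  apply ENNReal.ofReal_le_ofReal
  obtain ⟨hρ0, hρ1⟩ := rho_bounds hδ hy
  have h1 := one_le_dZ_psiZ_sq hδ hδ' hy
  have hr4 : cylRadius y ^ 4 = rho y ^ 2 := by rw [rho_eq_cylRadius_sq]; ring
  have hρpos : 0 < rho y := by nlinarith
  have hr4pos : 0 < cylRadius y ^ 4 := by rw [hr4]; positivity
  have hr4lt : cylRadius y ^ 4 ≤ 289 * δ ^ 4 := by rw [hr4]; nlinarith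
  calc 1 / (289 * δ ^ 4) ≤ 1 / cylRadius y ^ 4 := one_div_le_one_div_of_le hr4pos hr4lt
    _ ≤ dZ psiZ y ^ 2 / cylRadius y ^ 4 := div_le_div_of_nonneg_right h1 hr4pos.le

/-- The left side of (3.25) for the witness (verbatim integrand of `Ineq325 1 1 c psiZ omZ`). [cite: Zajaczkowski2023, (3.25) p.17 l.28–57] -/
def lhs325 (x : E3) : ℝ≥0∞ :=
  ENNReal.ofReal (dZ (dZ psiZ) x ^ 2 / cylRadius x ^ 2) + ENNReal.ofReal (dR (dR (dZ psiZ)) x ^ 2) +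
    ENNReal.ofReal (dR (dZ psiZ) x ^ 2 / cylRadius x ^ 2) + ENNReal.ofReal (dZ psiZ x ^ 2 / cylRadius x ^ 4)

/-- **Ball lower bound**: `∫_Ω (3.25-left) ≥ |B₁|/(289 δ)` for every `0 < δ ≤ 1/8`. [folklore] -/
theorem lintegral_lhs325_ge {δ : ℝ} (hδ : 0 < δ) (hδ' : δ ≤ 1 / 8) :
    ENNReal.ofReal (1 / (289 * δ)) * volume (ball (0 : E3) 1) ≤ ∫⁻ x in cell 1 1, lhs325 x := by
  have hball : volume (ball (ctr δ) δ) = ENNReal.ofReal (δ ^ 3) * volume (ball (0 : E3) 1) := by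
    rw [Measure.addHaar_ball_of_pos volume (ctr δ) hδ, finrank_euclideanSpace_fin]
  calc ENNReal.ofReal (1 / (289 * δ)) * volume (ball (0 : E3) 1)
        = ENNReal.ofReal (1 / (289 * δ ^ 4)) * volume (ball (ctr δ) δ) := by
          rw [hball, ← mul_assoc, ← ENNReal.ofReal_mul (by positivity)]
          congr 2
          field_simp
    _ = ∫⁻ _ in ball (ctr δ) δ, ENNReal.ofReal (1 / (289 * δ ^ 4)) := (setLIntegral_const _ _).symm
    _ ≤ ∫⁻ x in ball (ctr δ) δ, lhs325 x := by
          refine setLIntegral_mono' measurableSet_ball fun y hy => ?_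
          exact (weight_lower_bound hδ hδ' hy).trans le_add_self
    _ ≤ ∫⁻ x in cell 1 1, lhs325 x := lintegral_mono_set (ball_subset_cell hδ hδ')

/-- **The left side of (3.25) is `⊤` for the witness.** [cite: Zajaczkowski2023, (3.25) p.17 l.28–57] -/
theorem lintegral_lhs325_eq_top : ∫⁻ x in cell 1 1, lhs325 x = ⊤ := by
  by_contra hne
  have hVpos : 0 < (volume (ball (0 : E3) 1)).toReal :=
    ENNReal.toReal_pos (measure_ball_pos volume (0 : E3) one_pos).ne' measure_ball_lt_top.ne
  set A := ∫⁻ x in cell 1 1, lhs325 x with hA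
  obtain ⟨N, hN⟩ := exists_nat_gt (A.toReal / (volume (ball (0 : E3) 1)).toReal)
  have hδ : (0 : ℝ) < 1 / (289 * (N + 1)) := by positivity
  have hδ' : (1 : ℝ) / (289 * (N + 1)) ≤ 1 / 8 :=
    one_div_le_one_div_of_le (by norm_num) (by nlinarith [N.cast_nonneg (α := ℝ)])
  have key := lintegral_lhs325_ge hδ hδ'
  rw [show (1 : ℝ) / (289 * (1 / (289 * (N + 1)))) = N + 1 by field_simp] at key
  have h1 := ENNReal.toReal_mono hne key
  rw [ENNReal.toReal_mul, ENNReal.toReal_ofReal (by positivity)] at h1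
  rw [div_lt_iff₀ hVpos] at hN; nlinarith

/-! ## The right side of (3.25) is finite for the witness -/

/-- The cell is measurable (open). [folklore] -/
theorem measurableSet_cell : MeasurableSet (cell (1 : ℝ) 1) := by
  have h1 : IsOpen {x : E3 | cylRadius x < 1} := isOpen_lt continuous_cylRadius continuous_const
  have h2 : IsOpen {x : E3 | x 2 ∈ Ioo (-1 : ℝ) 1} := isOpen_Ioo.preimage (contDiff_coord (n := 0) 2).continuous
  exact (h1.inter h2).measurableSet

/-- The cell lies in the ball of radius `2`. [folklore] -/
theorem cell_subset_ball : cell (1 : ℝ) 1 ⊆ ball (0 : E3) 2 := by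
  intro y hy
  obtain ⟨hr, hz⟩ := hy
  rw [mem_Ioo] at hz; rw [mem_ball_zero_iff]
  have hn : ‖y‖ ^ 2 = y 0 ^ 2 + y 1 ^ 2 + y 2 ^ 2 := by
    rw [EuclideanSpace.norm_sq_eq, Fin.sum_univ_three]; simp [Real.norm_eq_abs, sq_abs]
  have hr2 : y 0 ^ 2 + y 1 ^ 2 < 1 := by rw [← cylRadius_sq]; have := cylRadius_nonneg y; nlinarith
  have hz2 : y 2 ^ 2 < 1 := by nlinarith
  nlinarith [norm_nonneg y]

/-- `ω²_{1,z} ≤ 9216` on the cell (`|8 + π²(1 − r²)| ≤ 24`, `π² sin² ≤ 16`). [folklore] -/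
theorem dZ_omZ_sq_le {y : E3} (hy : y ∈ cell (1 : ℝ) 1) : dZ omZ y ^ 2 ≤ 9216 := by
  rw [dZ_omZ]
  have hρ0 : 0 ≤ rho y := by unfold rho; nlinarith [mul_self_nonneg (y 0), mul_self_nonneg (y 1)]
  have hρ1 : rho y < 1 := by
    rw [rho_eq_cylRadius_sq]; have := hy.1; have h0 := cylRadius_nonneg y; nlinarith
  have ha0 : 0 ≤ 8 + π ^ 2 * gW y := by unfold gW; nlinarith [Real.pi_pos]
  have ha1 : 8 + π ^ 2 * gW y ≤ 24 := by
    unfold gW; nlinarith [Real.pi_pos, Real.pi_le_four, mul_pos Real.pi_pos Real.pi_pos]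
  have hb : sZ y ^ 2 ≤ 16 := by
    have hπ2 : π ^ 2 ≤ 16 := by nlinarith [Real.pi_pos, Real.pi_le_four]
    calc sZ y ^ 2 = π ^ 2 * Real.sin (π * y 2) ^ 2 := by unfold sZ; ring
      _ ≤ 16 * 1 := mul_le_mul hπ2 (Real.sin_sq_le_one _) (sq_nonneg _) (by norm_num)
      _ = 16 := by norm_num
  have ha2 : (8 + π ^ 2 * gW y) ^ 2 ≤ 576 := by nlinarith
  calc ((8 + π ^ 2 * gW y) * sZ y) ^ 2 = (8 + π ^ 2 * gW y) ^ 2 * sZ y ^ 2 := by ring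
    _ ≤ 576 * 16 := mul_le_mul ha2 hb (sq_nonneg _) (by norm_num)
    _ = 9216 := by norm_num

/-- **The right side of (3.25) is finite for the witness**, for every constant `c`. [folklore] -/
theorem rhs325_lt_top (c : ℝ) :
    ENNReal.ofReal c * ∫⁻ x in cell 1 1, ENNReal.ofReal (dZ omZ x ^ 2) < ⊤ := by
  have hle : ∫⁻ x in cell 1 1, ENNReal.ofReal (dZ omZ x ^ 2) ≤ ENNReal.ofReal 9216 * volume (ball (0 : E3) 2) :=
    calc ∫⁻ x in cell 1 1, ENNReal.ofReal (dZ omZ x ^ 2) ≤ ∫⁻ _ in cell 1 1, ENNReal.ofReal 9216 :=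
          setLIntegral_mono' measurableSet_cell fun y hy => ENNReal.ofReal_le_ofReal (dZ_omZ_sq_le hy)
      _ = ENNReal.ofReal 9216 * volume (cell (1 : ℝ) 1) := setLIntegral_const _ _
      _ ≤ ENNReal.ofReal 9216 * volume (ball (0 : E3) 2) := by gcongr; exact cell_subset_ball
  exact ENNReal.mul_lt_top ENNReal.ofReal_lt_top
    (hle.trans_lt (ENNReal.mul_lt_top ENNReal.ofReal_lt_top measure_ball_lt_top))

/-! ## Main results -/

/-- **(3.25) fails for the witness, whatever the constant**: `¬ Ineq325 1 1 c ψ₁ ω₁`. [cite: Zajaczkowski2023, (3.25) p.17 l.28–57] -/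
theorem not_ineq325_psiZ (c : ℝ) : ¬ Ineq325 1 1 c psiZ omZ := by
  intro h
  have h' : ∫⁻ x in cell 1 1, lhs325 x ≤ ENNReal.ofReal c * ∫⁻ x in cell 1 1, ENNReal.ofReal (dZ omZ x ^ 2) := h
  rw [lintegral_lhs325_eq_top, top_le_iff] at h'
  exact (rhs325_lt_top c).ne h'

/-- **LOAD-BEARING HYPOTHESIS — Lemma 3.3 WITHOUT its axis hypothesis is false** (the skeleton's `Step_L33` with
`∀ z, ψ₁ (axisPt z) = 0` deleted — the form a proof of (1.24) for the whole class (1.6) would need): the axis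
hypothesis of Lemma 3.3 cannot be dropped:
the smooth axisymmetric `2`-periodic pair `ψ₁ = (1 − r²) cos(π x₂)`, `ω₁ = (8 + π²(1 − r²)) cos(π x₂)` solves (3.1)
in the unit cylinder with `ψ₁|_{r=1} = 0`, its datum has `‖ω_{1,z}‖²_{L₂(Ω)} < ∞`, but `ψ_{1,z} = −π(1 − r²) sin(π x₂)`
does not vanish on the axis and the weight term `∫_Ω ψ²_{1,z} r⁻⁴ dx` of (3.25) is `+∞`. Records companion of
#162 (head `Step3_PlanItem3`, `…Zajaczkowski2023Columnar.not_Step3_PlanItem3`): the Edison clause's `Step_L33`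
keeps its hypothesis by necessity. [cite: Zajaczkowski2023, Lemma 3.3 (3.25) p.17 l.26–57; Remark 3.4 p.18 l.53–55; plan item 3 p.6 l.40–43] -/
theorem step_L33_false_without_axis :
    ¬ (∀ (R a : ℝ), 0 < R → 0 < a → ∃ c : ℝ, 0 < c ∧
        ∀ ψ₁ ω₁ : E3 → ℝ, SolvesStream R a ψ₁ ω₁ → Ineq325 R a c ψ₁ ω₁) := by
  intro h; obtain ⟨c, -, hc⟩ := h 1 1 one_pos one_pos; exact not_ineq325_psiZ c (hc psiZ omZ solvesStream_psiZ)

end Summit.NavierStokesRegularity.NavierStokesRegularity.Theorems.Zajaczkowski2023AxisWeight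

end

-- WHAT THIS IS NOT: not a claim about NS regularity or blow-up; not a claim about any author beyond the typed
-- locator.
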